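import Summits.AtomisticToContinuum.FouriersLaw.Theorems.BondHeatUncertaintyExtensiveSnapshotIrreversibilityEnergyWindowDensityFloorA

/-!
# «EnergyWindowDensityFloor» (lens-1 g73 node J: the two halves of A3, A1⁺ proved, the seam A3i → A3p → A3, placement from (R), the first rung of A3i (response identity on Range(L_{T,T})), A3i as weighted TV linear response) — part 2 of 3 (sequel of `…BondHeatUncertaintyExtensiveSnapshotIrreversibilityEnergyWindowDensityFloorA`)

Split for the 400-line cap by the landing lane (hand-2 g30); the module docstring of part 1 (`…BondHeatUncertaintyExtensiveSnapshotIrreversibilityEnergyWindowDensityFloorA`) describes the whole node.  Same namespace; all FQNs unchanged.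
0 sorry; standard axioms.
-/

noncomputable section

namespace Summit.AtomisticToContinuum.FouriersLaw.Theorems.ExtensiveSnapshotIrreversibility.EnergyWindow

open MeasureTheory Filter Topology Real
open scoped ENNReal NNReal
open Literature.MathematicalPhysics.KineticTheory.HeatConduction
-- landing revision (as in the landed `…EnergyWindowTree` / `…EnergyWindow`): the seat namespace `Tree` of re-proved tree lemmas is gone;
-- the originals are opened instead.
open Summit.AtomisticToContinuum.FouriersLaw.Theorems.ExtensiveSnapshotIrreversibility.Negative
open Summit.AtomisticToContinuum.FouriersLaw.Theorems.ExtensiveSnapshotIrreversibility.ClausiusBudget.OddLogDensity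

variable {N : ℕ}

/-- `|e^x − 1| ≤ |x| (e^x + 1)` (good on BOTH sides).  Private helper (moved here from the seat file's §0 on landing); the
public statement is the Literature's `Literature.Probability.MarkovChains.HMC.abs_exp_sub_one_le` [cite there], not imported
to keep this chain's import closure kinetic-theory only. [formal bookkeeping] -/
private theorem abs_exp_sub_one_le_abs_mul_exp_add_one (x : ℝ) : |exp x - 1| ≤ |x| * (exp x + 1) := by
  rcases le_or_gt 0 x with hx | hx
  · have h0 : 0 ≤ exp x - 1 := by linarith [add_one_le_exp x]
    rw [abs_of_nonneg h0, abs_of_nonneg hx]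
    have h := add_one_le_exp (-x)
    have h2 : exp x * (-x + 1) ≤ exp x * exp (-x) := mul_le_mul_of_nonneg_left h (exp_pos x).le
    rw [← exp_add, add_neg_cancel, exp_zero] at h2
    have e : exp x * (-x + 1) = exp x - x * exp x := by ring
    nlinarith [h2, e, exp_pos x, hx]
  · have h0 : exp x - 1 ≤ 0 := by linarith [Real.exp_le_one_iff.2 hx.le]
    rw [abs_of_neg hx, abs_of_nonpos h0]
    have h1 := add_one_le_exp x
    have h3 : 0 < -x * exp x := mul_pos (by linarith) (exp_pos x)
    nlinarith [h1, h3]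

/-! ## 4. Placement: A3 ⟹ A3p; `(R) ⟹ A3p`; `(R) ⟹ A3i` -/

/-- **A3 ⟹ A3p** (A3p is strictly on the way to A3): with A3 at slack `a`,
`1 − e^{φ} ≤ C₃|δ|(1+H)^m e^{aH} ≤ (max C₃ 0)(1+H)^m e^{(1/T−θ+a)H}(I + |δ|)` since `I ≥ 0` and
`1/T − θ > 0`. [folklore] -/
theorem nessDensityFloor_implies_floorMeanValue (h3 : NessDensityFloor) : NessFloorMeanValue := by
  intro ω₂ lam β γ hω hl hβ hγ hU μ hμ T hT N hN a ha θ hθ hθ1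
  have hH0 : ∀ x, 0 ≤ (pinnedChain ω₂ lam β γ).hamiltonian N x :=
    pinnedChain_hamiltonian_nonneg hω.le hl.le hβ.le γ N
  obtain ⟨δ₀, C₃, m, hδ₀, h⟩ := h3 ω₂ lam β γ hω hl hβ hγ hU μ hμ T hT N hN a ha
  refine ⟨δ₀, max C₃ 0, m, hδ₀, le_max_right _ _, fun δ hδ hδ' φ hφm hrep _ => ?_⟩
  have hI0 : 0 ≤ ∫ y, exp (θ * (pinnedChain ω₂ lam β γ).hamiltonian N y) *
      |exp (φ y) - 1| ∂((pinnedChain ω₂ lam β γ).gibbsMeasure N T) :=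
    integral_nonneg fun y => mul_nonneg (exp_pos _).le (abs_nonneg _)
  filter_upwards [h δ hδ hδ' φ hφm hrep] with x hx
  have hpm : 0 ≤ (1 + (pinnedChain ω₂ lam β γ).hamiltonian N x) ^ m :=
    pow_nonneg (by linarith [hH0 x]) _
  have hexp : exp (a * (pinnedChain ω₂ lam β γ).hamiltonian N x) ≤
      exp ((1 / T - θ + a) * (pinnedChain ω₂ lam β γ).hamiltonian N x) :=
    exp_le_exp.2 (mul_le_mul_of_nonneg_right (by linarith) (hH0 x))
  have hC : C₃ * |δ| * (1 + (pinnedChain ω₂ lam β γ).hamiltonian N x) ^ m *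
        exp (a * (pinnedChain ω₂ lam β γ).hamiltonian N x) ≤
      max C₃ 0 * |δ| * (1 + (pinnedChain ω₂ lam β γ).hamiltonian N x) ^ m *
        exp (a * (pinnedChain ω₂ lam β γ).hamiltonian N x) :=
    mul_le_mul_of_nonneg_right (mul_le_mul_of_nonneg_right
      (mul_le_mul_of_nonneg_right (le_max_left _ _) (abs_nonneg _)) hpm) (exp_pos _).le
  have key : max C₃ 0 * |δ| * (1 + (pinnedChain ω₂ lam β γ).hamiltonian N x) ^ m *
        exp (a * (pinnedChain ω₂ lam β γ).hamiltonian N x) ≤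
      max C₃ 0 * (1 + (pinnedChain ω₂ lam β γ).hamiltonian N x) ^ m *
        exp ((1 / T - θ + a) * (pinnedChain ω₂ lam β γ).hamiltonian N x) *
        ((∫ y, exp (θ * (pinnedChain ω₂ lam β γ).hamiltonian N y) *
          |exp (φ y) - 1| ∂((pinnedChain ω₂ lam β γ).gibbsMeasure N T)) + |δ|) := by
    calc max C₃ 0 * |δ| * (1 + (pinnedChain ω₂ lam β γ).hamiltonian N x) ^ m *
          exp (a * (pinnedChain ω₂ lam β γ).hamiltonian N x)
        = max C₃ 0 * (1 + (pinnedChain ω₂ lam β γ).hamiltonian N x) ^ m *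
            exp (a * (pinnedChain ω₂ lam β γ).hamiltonian N x) * |δ| := by ring
      _ ≤ max C₃ 0 * (1 + (pinnedChain ω₂ lam β γ).hamiltonian N x) ^ m *
            exp ((1 / T - θ + a) * (pinnedChain ω₂ lam β γ).hamiltonian N x) *
            ((∫ y, exp (θ * (pinnedChain ω₂ lam β γ).hamiltonian N y) *
              |exp (φ y) - 1| ∂((pinnedChain ω₂ lam β γ).gibbsMeasure N T)) + |δ|) :=
          mul_le_mul (mul_le_mul_of_nonneg_left hexp (mul_nonneg (le_max_right _ _) hpm))
            (by linarith [abs_nonneg δ]) (abs_nonneg _) (by positivity)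
  linarith [hx, hC, key]

/-- **`(R) ⟹ A3p`** (`C = max C 0`, `m = k`, the same `δ₀`; any representative `ψ` equals `φ_δ`
a.e. by `ae_eq_of_withDensity_exp_eq`, and `1 − e^{φ_δ} ≤ −φ_δ ≤ C|δ|(1+H)^k`). [folklore] -/
theorem nessFloorMeanValue_of_logDensityRegularity (hR : LogDensityRegularity) :
    NessFloorMeanValue := by
  intro ω₂ lam β γ hω hl hβ hγ hU μ hμ T hT N hN a ha θ hθ hθ1
  obtain ⟨δ₀, η, C, k, hδ₀, hη, hη4, φ, h₀, hφm, hh₀m, hR1, hR2, hR3, hR4⟩ :=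
    hR ω₂ lam β γ hω hl hβ hγ hU μ hμ T hT N hN
  haveI : IsProbabilityMeasure ((pinnedChain ω₂ lam β γ).gibbsMeasure N T) :=
    pinnedChain_isProbabilityMeasure_gibbsMeasure hω hl.le hβ.le γ N hT
  have hH0 : ∀ x, 0 ≤ (pinnedChain ω₂ lam β γ).hamiltonian N x :=
    pinnedChain_hamiltonian_nonneg hω.le hl.le hβ.le γ N
  refine ⟨δ₀, max C 0, k, hδ₀, le_max_right _ _, fun δ hδ hδ' ψ hψm hψ _ => ?_⟩
  have hae : ∀ᵐ x ∂((pinnedChain ω₂ lam β γ).gibbsMeasure N T), ψ x = φ δ x :=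
    ae_eq_of_withDensity_exp_eq hψm (hφm δ) (hψ.symm.trans (hR1 δ hδ hδ'))
  have hI0 : 0 ≤ ∫ y, exp (θ * (pinnedChain ω₂ lam β γ).hamiltonian N y) *
      |exp (ψ y) - 1| ∂((pinnedChain ω₂ lam β γ).gibbsMeasure N T) :=
    integral_nonneg fun y => mul_nonneg (exp_pos _).le (abs_nonneg _)
  filter_upwards [hae] with x hx
  rw [hx]
  have h1 : 0 ≤ (1 + (pinnedChain ω₂ lam β γ).hamiltonian N x) ^ k :=
    pow_nonneg (by linarith [hH0 x]) _
  have h3 : -(C * |δ| * (1 + (pinnedChain ω₂ lam β γ).hamiltonian N x) ^ k) ≤ φ δ x :=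
    (abs_le.1 (hR3 δ hδ' x)).1
  have hC : C * |δ| * (1 + (pinnedChain ω₂ lam β γ).hamiltonian N x) ^ k ≤
      max C 0 * |δ| * (1 + (pinnedChain ω₂ lam β γ).hamiltonian N x) ^ k :=
    mul_le_mul_of_nonneg_right (mul_le_mul_of_nonneg_right (le_max_left _ _) (abs_nonneg _)) h1
  have hexp1 : 1 ≤ exp ((1 / T - θ + a) * (pinnedChain ω₂ lam β γ).hamiltonian N x) :=
    one_le_exp (mul_nonneg (by linarith) (hH0 x))
  have key : max C 0 * |δ| * (1 + (pinnedChain ω₂ lam β γ).hamiltonian N x) ^ k ≤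
      max C 0 * (1 + (pinnedChain ω₂ lam β γ).hamiltonian N x) ^ k *
        exp ((1 / T - θ + a) * (pinnedChain ω₂ lam β γ).hamiltonian N x) *
        ((∫ y, exp (θ * (pinnedChain ω₂ lam β γ).hamiltonian N y) *
          |exp (ψ y) - 1| ∂((pinnedChain ω₂ lam β γ).gibbsMeasure N T)) + |δ|) := by
    calc max C 0 * |δ| * (1 + (pinnedChain ω₂ lam β γ).hamiltonian N x) ^ k
        = max C 0 * (1 + (pinnedChain ω₂ lam β γ).hamiltonian N x) ^ k * 1 * |δ| := by ring
      _ ≤ max C 0 * (1 + (pinnedChain ω₂ lam β γ).hamiltonian N x) ^ k *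
            exp ((1 / T - θ + a) * (pinnedChain ω₂ lam β γ).hamiltonian N x) *
            ((∫ y, exp (θ * (pinnedChain ω₂ lam β γ).hamiltonian N y) *
              |exp (ψ y) - 1| ∂((pinnedChain ω₂ lam β γ).gibbsMeasure N T)) + |δ|) :=
          mul_le_mul (mul_le_mul_of_nonneg_left hexp1 (mul_nonneg (le_max_right _ _) h1))
            (by linarith) (abs_nonneg _) (by positivity)
  have h5 : φ δ x + 1 ≤ exp (φ δ x) := add_one_le_exp _
  linarith

/-- **`(R) ⟹ A3i`** (given A1⁺, which is proved): with `θ < θ' := (θ + 1/T)/2 < 1/T`, (R3) and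
`|e^{φ} − 1| ≤ |φ|(e^{φ} + 1)` give `e^{θH}|e^{φ_δ} − 1| ≤ (max C 0)|δ| (1+H)^k e^{θH} (e^{φ_δ} + 1)`;
`(1+H)^k e^{θH} ≤ K_k e^{θ'H}` (`K_k = k! e^{θ'−θ}/(θ'−θ)^k`) and `∫ e^{θ'H} e^{φ_δ} dμ_T =
∫ e^{θ'H} dμ_δ ≤ C₁` (A1⁺ at `θ'`, tilted representation), `∫ (1+H)^k e^{θH} dμ_T < ∞`; any
representative `ψ` equals `φ_δ` a.e. [folklore] -/
theorem nessWeightedL1Response_of_logDensityRegularity (hR : LogDensityRegularity) :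
    NessWeightedL1Response := by
  intro ω₂ lam β γ hω hl hβ hγ hU μ hμ T hT N hN θ hθ hθ1
  obtain ⟨δR, η, C, k, hδR, hη, hη4, φ, h₀, hφm, hh₀m, hR1, hR2, hR3, hR4⟩ :=
    hR ω₂ lam β γ hω hl hβ hγ hU μ hμ T hT N hN
  set P := pinnedChain ω₂ lam β γ with hP
  set μT := P.gibbsMeasure N T with hμT
  haveI : IsProbabilityMeasure μT :=
    pinnedChain_isProbabilityMeasure_gibbsMeasure hω hl.le hβ.le γ N hT
  have hH0 : ∀ x, 0 ≤ P.hamiltonian N x := pinnedChain_hamiltonian_nonneg hω.le hl.le hβ.le γ N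
  have hHm : Measurable (P.hamiltonian N) := (pinnedChain_continuous_hamiltonian ω₂ lam β γ N).measurable
  -- the auxiliary rate `θ'` and the polynomial absorption constant
  set θ' : ℝ := (θ + 1 / T) / 2 with hθ'def
  have hθ'0 : 0 < θ' := by rw [hθ'def]; positivity
  have hθθ' : θ < θ' := by rw [hθ'def]; linarith
  have hθ'1 : θ' < 1 / T := by rw [hθ'def]; linarith
  have hs : 0 < θ' - θ := by linarith
  set Kk : ℝ := k.factorial * exp (θ' - θ) / (θ' - θ) ^ k with hKk
  have hKk0 : 0 ≤ Kk := by rw [hKk]; positivity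
  have hpoly : ∀ x, (1 + P.hamiltonian N x) ^ k * exp (θ * P.hamiltonian N x) ≤
      Kk * exp (θ' * P.hamiltonian N x) := by
    intro x
    calc (1 + P.hamiltonian N x) ^ k * exp (θ * P.hamiltonian N x)
        ≤ Kk * exp ((θ' - θ) * P.hamiltonian N x) * exp (θ * P.hamiltonian N x) :=
          mul_le_mul_of_nonneg_right (one_add_pow_le_factorial_mul_exp k (hH0 x) hs) (exp_pos _).le
      _ = Kk * exp (θ' * P.hamiltonian N x) := by
          rw [mul_assoc, ← exp_add]; congr 2; ring
  -- A1⁺ at `θ'`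
  obtain ⟨δA, C₁, hδA, hA1⟩ :=
    nessExpMomentBoundFull_holds ω₂ lam β γ hω hl hβ hγ hU μ hμ T hT N hN θ' hθ'0 hθ'1
  -- the Gibbs-side constant
  have hIM : Integrable (fun x => (1 + P.hamiltonian N x) ^ k * exp (θ * P.hamiltonian N x)) μT :=
    integrable_one_add_pow_mul_exp_gibbs hω hl.le hβ.le γ N k hT hθ1
  set M : ℝ := ∫ x, (1 + P.hamiltonian N x) ^ k * exp (θ * P.hamiltonian N x) ∂μT with hM
  -- radius
  set δ₀ : ℝ := min (min δR δA) T with hδ₀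
  have hδ₀pos : 0 < δ₀ := lt_min (lt_min hδR hδA) hT
  refine ⟨δ₀, max C 0 * (Kk * C₁ + M), hδ₀pos, fun δ hδ hδ' ψ hψm hψ => ?_⟩
  have hδR' : |δ| < δR := hδ'.trans_le ((min_le_left _ _).trans (min_le_left _ _))
  have hδA' : |δ| < δA := hδ'.trans_le ((min_le_left _ _).trans (min_le_right _ _))
  have hδT : |δ| < T := hδ'.trans_le (min_le_right _ _)
  have hTL : 0 < T + δ / 2 := by linarith [neg_abs_le δ]
  have hTR : 0 < T - δ / 2 := by linarith [le_abs_self δ]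
  haveI : IsProbabilityMeasure (μ N (T + δ / 2) (T - δ / 2)) := (hμ N _ _ hTL hTR).1
  -- the representative `ψ` equals `φ δ` a.e.
  have hae : ∀ᵐ x ∂μT, ψ x = φ δ x :=
    ae_eq_of_withDensity_exp_eq hψm (hφm δ) (hψ.symm.trans (hR1 δ hδ hδR'))
  -- tilted representation and the `θ'`-moment of `μ_δ` pulled back to `μ_T`
  obtain ⟨hiφ, hz1, htilt⟩ := tilted_of_withDensity_exp (hφm δ) (hR1 δ hδ hδR')
  obtain ⟨hintA, hleA⟩ := hA1 δ hδ hδA'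
  rw [htilt, integrable_tilted_iff hiφ] at hintA
  rw [htilt, integral_tilted] at hleA
  have hintA' : Integrable (fun x => exp (φ δ x) * exp (θ' * P.hamiltonian N x)) μT :=
    hintA.congr (ae_of_all _ fun x => by simp only [smul_eq_mul]; rfl)
  have hleA' : ∫ x, exp (φ δ x) * exp (θ' * P.hamiltonian N x) ∂μT ≤ C₁ := by
    calc ∫ x, exp (φ δ x) * exp (θ' * P.hamiltonian N x) ∂μT
        = ∫ x, (exp (φ δ x) / ∫ x, exp (φ δ x) ∂μT) • exp (θ' * P.hamiltonian N x) ∂μT := by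
          refine integral_congr_ae (ae_of_all _ fun x => ?_)
          simp only [hz1, div_one, smul_eq_mul]
      _ ≤ C₁ := hleA
  -- the dominating function
  set B : PhaseSpace N → ℝ := fun x => max C 0 * |δ| *
    (Kk * (exp (φ δ x) * exp (θ' * P.hamiltonian N x)) +
      (1 + P.hamiltonian N x) ^ k * exp (θ * P.hamiltonian N x)) with hB
  have hBint : Integrable B μT := ((hintA'.const_mul Kk).add hIM).const_mul _
  have hdom : ∀ x, exp (θ * P.hamiltonian N x) * |exp (φ δ x) - 1| ≤ B x := by
    intro x
    have hR3x := hR3 δ hδR' x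
    have hpk : 0 ≤ (1 + P.hamiltonian N x) ^ k := pow_nonneg (by linarith [hH0 x]) _
    have hφb : |φ δ x| ≤ max C 0 * |δ| * (1 + P.hamiltonian N x) ^ k :=
      hR3x.trans (mul_le_mul_of_nonneg_right
        (mul_le_mul_of_nonneg_right (le_max_left _ _) (abs_nonneg _)) hpk)
    have h1 : |exp (φ δ x) - 1| ≤ max C 0 * |δ| * (1 + P.hamiltonian N x) ^ k * (exp (φ δ x) + 1) :=
      (abs_exp_sub_one_le_abs_mul_exp_add_one _).trans
        (mul_le_mul_of_nonneg_right hφb (by positivity))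
    have hE0 : 0 ≤ exp (θ * P.hamiltonian N x) := (exp_pos _).le
    calc exp (θ * P.hamiltonian N x) * |exp (φ δ x) - 1|
        ≤ exp (θ * P.hamiltonian N x) *
            (max C 0 * |δ| * (1 + P.hamiltonian N x) ^ k * (exp (φ δ x) + 1)) :=
          mul_le_mul_of_nonneg_left h1 hE0
      _ = max C 0 * |δ| * (((1 + P.hamiltonian N x) ^ k * exp (θ * P.hamiltonian N x)) * exp (φ δ x) +
            (1 + P.hamiltonian N x) ^ k * exp (θ * P.hamiltonian N x)) := by ring
      _ ≤ max C 0 * |δ| * (Kk * exp (θ' * P.hamiltonian N x) * exp (φ δ x) +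
            (1 + P.hamiltonian N x) ^ k * exp (θ * P.hamiltonian N x)) := by
          have hA : (1 + P.hamiltonian N x) ^ k * exp (θ * P.hamiltonian N x) * exp (φ δ x) ≤
              Kk * exp (θ' * P.hamiltonian N x) * exp (φ δ x) :=
            mul_le_mul_of_nonneg_right (hpoly x) (exp_pos _).le
          have hc0 : 0 ≤ max C 0 * |δ| := mul_nonneg (le_max_right C 0) (abs_nonneg δ)
          exact mul_le_mul_of_nonneg_left (by linarith [hA]) hc0
      _ = B x := by rw [hB]; ring
  -- integrability of the signed defect and the bound
  have hmeas : AEStronglyMeasurable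
      (fun x => exp (θ * P.hamiltonian N x) * (exp (ψ x) - 1)) μT :=
    ((hHm.const_mul θ).exp.mul (hψm.exp.sub measurable_const)).aestronglyMeasurable
  have hint : Integrable (fun x => exp (θ * P.hamiltonian N x) * (exp (ψ x) - 1)) μT := by
    refine hBint.mono' hmeas ?_
    filter_upwards [hae] with x hx
    rw [hx, Real.norm_eq_abs, abs_mul, abs_of_pos (exp_pos _)]
    exact hdom x
  refine ⟨hint, ?_⟩
  have hintabs : Integrable (fun x => exp (θ * P.hamiltonian N x) * |exp (ψ x) - 1|) μT := by
    refine hint.abs.congr (ae_of_all _ fun x => ?_)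
    simp only [abs_mul, abs_of_pos (exp_pos _)]
  calc ∫ x, exp (θ * P.hamiltonian N x) * |exp (ψ x) - 1| ∂μT
      ≤ ∫ x, B x ∂μT := by
        refine integral_mono_ae hintabs hBint ?_
        filter_upwards [hae] with x hx
        rw [hx]
        exact hdom x
    _ = max C 0 * |δ| * (Kk * ∫ x, exp (φ δ x) * exp (θ' * P.hamiltonian N x) ∂μT + M) := by
        rw [hB, integral_const_mul, integral_add (hintA'.const_mul Kk) hIM, integral_const_mul]
    _ ≤ max C 0 * |δ| * (Kk * C₁ + M) := by
        have hc0 : 0 ≤ max C 0 * |δ| := mul_nonneg (le_max_right C 0) (abs_nonneg δ)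
        exact mul_le_mul_of_nonneg_left (by nlinarith [hleA', hKk0]) hc0
    _ = max C 0 * (Kk * C₁ + M) * |δ| := by ring

/-- **`(R) ⟹ A3` through the split** (consistency: the new seam re-derives file I's
`nessDensityFloor_of_logDensityRegularity` — same statement, hence an `example`, not a second declaration; the seat's
name `nessDensityFloor_of_logDensityRegularity_viaSplit` was dedup-bounced p850249). [folklore] -/
example (hR : LogDensityRegularity) : NessDensityFloor :=
  nessDensityFloor_of_weightedL1Response_of_floorMeanValue
    (nessWeightedL1Response_of_logDensityRegularity hR) (nessFloorMeanValue_of_logDensityRegularity hR)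

end Summit.AtomisticToContinuum.FouriersLaw.Theorems.ExtensiveSnapshotIrreversibility.EnergyWindow

end
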